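import Summits.AnomalousDissipation.AnomalousDissipation.Theorems.TaylorCertificatePair.Negative.Frame

/-!
# Coefficient, pairing and energy-channel bounds; the far shear state; the state of rest

Crux `TaylorCertificates.TaylorCertificatePair` (stmt-AnomalousDissipation-13037), negative side
(cdisprove seat `refuter-cdisprove-stmt-AnomalousDissipation-13037-0`): support for the refutation
`Theorems/TaylorCertificatesTaylorCertificatePairRefutation.lean` (CEILING killed by an unresolved beat).
All statements are written over the tree's objects directly (no new definitions): single real modes
`Torus.realTrigPoly {k} (fun _ => z) = Re (e_k • z)`, mode sums `∑ₘ Torus.realTrigPoly {k m} (fun _ => z m)`,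
Fourier coefficients `mFourierCoeff (complexify ∘ ·)`, the transversal products `(fun j => (κ j : ℂ)) ⬝ᵥ z`.

* `(f, G) ≤ ‖f‖₂ 𝔊` for band-limited `G` (`𝔊 = √(∑_{|k|≤N} ‖Ĝ(k)‖²)`), `#ball ≤ (2N+1)³`, `𝔊² ≤ #ball · max ‖Ĝ‖²`;
* the energy channel with a weight `θ ∈ [−Θ, 0]`; the far shear state `(F/ν)√2 cos(2πx₂)e₀` and its energy;
  Laplacian and force pairings of the two concrete states;
* at rest (`u = 0`) every term of the certificate vanishes for an a.e.-vanishing force.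
-/

noncomputable section

open MeasureTheory UnitAddTorus Matrix
open scoped InnerProductSpace ENNReal ComplexConjugate

namespace Summit.AnomalousDissipation.AnomalousDissipation.Theorems.TaylorCertificatePair.Negative

open Literature.Analysis.FunctionSpaces Literature.Analysis.FluidPDE

/-! ### Coefficient and pairing bounds -/

/-- `Re ⟪a, b⟫ ≤ ‖a‖ ‖b‖`. -/
theorem re_inner_le_norm_mul (a b : (EuclideanSpace ℂ (Fin 3))) : (⟪a, b⟫_ℂ).re ≤ ‖a‖ * ‖b‖ :=
  (Complex.re_le_norm _).trans (norm_inner_le_norm a b)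

/-- `|Re ⟪a, b⟫| ≤ ‖a‖ ‖b‖`. -/
theorem abs_re_inner_le_norm_mul (a b : (EuclideanSpace ℂ (Fin 3))) : |(⟪a, b⟫_ℂ).re| ≤ ‖a‖ * ‖b‖ :=
  (Complex.abs_re_le_norm _).trans (norm_inner_le_norm a b)

/-- A single Fourier coefficient is bounded by the `L²` norm. -/
theorem norm_fc_le_sqrt_integral {f : (UnitAddTorus (Fin 3)) → (EuclideanSpace ℝ (Fin 3))} (hf : MemLp f 2 volume) (κ : Fin 3 → ℤ) :
    ‖(mFourierCoeff (EuclideanSpace.complexify ∘ f) κ)‖ ≤ Real.sqrt (∫ x, ‖f x‖ ^ 2) := by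
  have h := Torus.hasSum_sq_norm_mFourierCoeff_complexify hf
  have h1 : ‖(mFourierCoeff (EuclideanSpace.complexify ∘ f) κ)‖ ^ 2 ≤ ∫ x, ‖f x‖ ^ 2 :=
    le_hasSum h κ fun κ' _ => sq_nonneg _
  calc ‖(mFourierCoeff (EuclideanSpace.complexify ∘ f) κ)‖ = Real.sqrt (‖(mFourierCoeff (EuclideanSpace.complexify ∘ f) κ)‖ ^ 2) := (Real.sqrt_sq (norm_nonneg _)).symm
    _ ≤ Real.sqrt (∫ x, ‖f x‖ ^ 2) := Real.sqrt_le_sqrt h1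

/-- The truncated coefficient norm is nonnegative. -/
theorem coeffNorm_nonneg (N : ℕ) (G : (UnitAddTorus (Fin 3)) → (EuclideanSpace ℝ (Fin 3))) : 0 ≤ (Real.sqrt (∑ κ' ∈ Torus.freqBall N, ‖mFourierCoeff (EuclideanSpace.complexify ∘ G) κ'‖ ^ 2)) := Real.sqrt_nonneg _

/-- A single coefficient of a band-limited field is bounded by the truncated `ℓ²` norm. -/
theorem norm_fc_le_coeffNorm {G : (UnitAddTorus (Fin 3)) → (EuclideanSpace ℝ (Fin 3))} {N : ℕ}
    (hband : ∀ κ, (N : ℝ) ^ 2 < Torus.freqNormSq κ → mFourierCoeff (EuclideanSpace.complexify ∘ G) κ = 0)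
    (κ : Fin 3 → ℤ) : ‖(mFourierCoeff (EuclideanSpace.complexify ∘ G) κ)‖ ≤ (Real.sqrt (∑ κ' ∈ Torus.freqBall N, ‖mFourierCoeff (EuclideanSpace.complexify ∘ G) κ'‖ ^ 2)) := by
  by_cases hκ : κ ∈ Torus.freqBall N
  · calc ‖(mFourierCoeff (EuclideanSpace.complexify ∘ G) κ)‖ = Real.sqrt (‖(mFourierCoeff (EuclideanSpace.complexify ∘ G) κ)‖ ^ 2) := (Real.sqrt_sq (norm_nonneg _)).symm
      _ ≤ Real.sqrt (∑ κ' ∈ Torus.freqBall N, ‖(mFourierCoeff (EuclideanSpace.complexify ∘ G) κ')‖ ^ 2) :=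
          Real.sqrt_le_sqrt (Finset.single_le_sum (f := fun κ' => ‖(mFourierCoeff (EuclideanSpace.complexify ∘ G) κ')‖ ^ 2)
            (fun _ _ => sq_nonneg _) hκ)
  · have : (mFourierCoeff (EuclideanSpace.complexify ∘ G) κ) = 0 := hband κ (Torus.not_mem_freqBall.1 hκ)
    rw [this, norm_zero]
    exact Real.sqrt_nonneg _

/-- **The resolved forcing term**: `(f, G) ≤ ‖f‖₂ · 𝔊` for band-limited `G`. -/
theorem integral_inner_le_coeffNorm {f G : (UnitAddTorus (Fin 3)) → (EuclideanSpace ℝ (Fin 3))} (hf : MemLp f 2 volume) (hG : Continuous G) {N : ℕ}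
    (hband : ∀ κ, (N : ℝ) ^ 2 < Torus.freqNormSq κ → mFourierCoeff (EuclideanSpace.complexify ∘ G) κ = 0) :
    ∫ x, ⟪f x, G x⟫_ℝ ≤ Real.sqrt (∫ x, ‖f x‖ ^ 2) * (Real.sqrt (∑ κ' ∈ Torus.freqBall N, ‖mFourierCoeff (EuclideanSpace.complexify ∘ G) κ'‖ ^ 2)) := by
  have hGm : MemLp G 2 volume := hG.memLp_of_hasCompactSupport (HasCompactSupport.of_compactSpace G)
  rw [Torus.integral_inner_eq_sum_freqBall hf hGm hband]
  calc ∑ κ ∈ Torus.freqBall N, (⟪mFourierCoeff (EuclideanSpace.complexify ∘ f) κ,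
          mFourierCoeff (EuclideanSpace.complexify ∘ G) κ⟫_ℂ).re
      ≤ ∑ κ ∈ Torus.freqBall N, ‖(mFourierCoeff (EuclideanSpace.complexify ∘ f) κ)‖ * ‖(mFourierCoeff (EuclideanSpace.complexify ∘ G) κ)‖ :=
        Finset.sum_le_sum fun κ _ => re_inner_le_norm_mul _ _
    _ ≤ Real.sqrt (∑ κ ∈ Torus.freqBall N, ‖(mFourierCoeff (EuclideanSpace.complexify ∘ f) κ)‖ ^ 2) * (Real.sqrt (∑ κ' ∈ Torus.freqBall N, ‖mFourierCoeff (EuclideanSpace.complexify ∘ G) κ'‖ ^ 2)) :=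
        by
          rw [← Real.sqrt_mul (Finset.sum_nonneg fun i _ => sq_nonneg _)]
          exact (le_abs_self _).trans (Real.abs_le_sqrt (Finset.sum_mul_sq_le_sq_mul_sq _ _ _))
    _ ≤ Real.sqrt (∫ x, ‖f x‖ ^ 2) * (Real.sqrt (∑ κ' ∈ Torus.freqBall N, ‖mFourierCoeff (EuclideanSpace.complexify ∘ G) κ'‖ ^ 2)) := by
        refine mul_le_mul_of_nonneg_right (Real.sqrt_le_sqrt ?_) (coeffNorm_nonneg N G)
        exact sum_le_hasSum _ (fun κ _ => sq_nonneg _)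
          (Torus.hasSum_sq_norm_mFourierCoeff_complexify hf)

/-- Cardinality of the frequency ball: `#{|k|² ≤ N²} ≤ (2N+1)³`. -/
theorem card_freqBall_le (N : ℕ) :
    ((Torus.freqBall (d := Fin 3) N).card : ℝ) ≤ (2 * (N : ℝ) + 1) ^ 3 := by
  have h1 : (Torus.freqBall (d := Fin 3) N).card ≤
      (Fintype.piFinset fun _ : Fin 3 => Finset.Icc (-(N : ℤ)) N).card := Finset.card_filter_le _ _
  rw [Fintype.card_piFinset, Finset.prod_const, Finset.card_univ, Fintype.card_fin, Int.card_Icc] at h1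
  have h2 : ((N : ℤ) + 1 - -(N : ℤ)).toNat = 2 * N + 1 := by omega
  rw [h2] at h1
  exact_mod_cast h1

/-- The largest coefficient controls the truncated norm: `𝔊² ≤ #ball · max ‖Ĝ‖²`. -/
theorem coeffNorm_sq_le_card_mul {G : (UnitAddTorus (Fin 3)) → (EuclideanSpace ℝ (Fin 3))} {N : ℕ} {q : Fin 3 → ℤ}
    (hq : ∀ κ ∈ Torus.freqBall N, ‖(mFourierCoeff (EuclideanSpace.complexify ∘ G) κ)‖ ≤ ‖(mFourierCoeff (EuclideanSpace.complexify ∘ G) q)‖) :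
    (Real.sqrt (∑ κ' ∈ Torus.freqBall N, ‖mFourierCoeff (EuclideanSpace.complexify ∘ G) κ'‖ ^ 2)) ^ 2 ≤ (Torus.freqBall (d := Fin 3) N).card * ‖(mFourierCoeff (EuclideanSpace.complexify ∘ G) q)‖ ^ 2 := by
  rw [Real.sq_sqrt (Finset.sum_nonneg fun κ _ => sq_nonneg _)]
  calc ∑ κ ∈ Torus.freqBall N, ‖(mFourierCoeff (EuclideanSpace.complexify ∘ G) κ)‖ ^ 2 ≤ ∑ _κ ∈ Torus.freqBall N, ‖(mFourierCoeff (EuclideanSpace.complexify ∘ G) q)‖ ^ 2 :=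
        Finset.sum_le_sum fun κ hκ => pow_le_pow_left₀ (norm_nonneg _) (hq κ hκ) 2
    _ = (Torus.freqBall (d := Fin 3) N).card * ‖(mFourierCoeff (EuclideanSpace.complexify ∘ G) q)‖ ^ 2 := by rw [Finset.sum_const, nsmul_eq_mul]

/-! ### The energy channel -/

/-- The energy channel with weight `θ ∈ [-Θ, 0]`: `2θ(P - D) ≤ 2Θ |P|⁺ + 2Θ D⁺`. -/
theorem energy_channel_bound {θ Θ P D PB DB : ℝ} (hθ : -Θ ≤ θ) (hθ' : θ ≤ 0) (hP : |P| ≤ PB)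
    (hD0 : 0 ≤ D) (hD : D ≤ DB) : 2 * θ * (P - D) ≤ 2 * Θ * PB + 2 * Θ * DB := by
  have hΘ : 0 ≤ Θ := by linarith
  have h1 : θ * P ≤ Θ * PB := by
    have h := le_abs_self (θ * P)
    rw [abs_mul, abs_of_nonpos hθ'] at h
    exact h.trans (mul_le_mul (by linarith) hP (abs_nonneg _) hΘ)
  have h2 : -(θ * D) ≤ Θ * DB := by
    calc -(θ * D) = (-θ) * D := by ring
      _ ≤ Θ * DB := mul_le_mul (by linarith) hD hD0 hΘ
  linarith

/-! ### The far shear state -/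

/-- `‖zsh F ν‖ = (F/ν)√2`. -/
theorem norm_zsh {F ν : ℝ} (hF : 0 ≤ F) (hν : 0 < ν) : ‖((((F) / (ν) * Real.sqrt 2 : ℝ) : ℂ) • (EuclideanSpace.complexify (EuclideanSpace.single (0 : Fin 3) (1 : ℝ)) : EuclideanSpace ℂ (Fin 3)))‖ = F / ν * Real.sqrt 2 := by
  rw [norm_smul, norm_zhat, mul_one, Complex.norm_real, Real.norm_of_nonneg (by positivity)]

/-- The shear polarisation is transversal. -/
theorem dotc_e2_zsh (F ν : ℝ) : ((fun j => (((![0, 1, 0] : Fin 3 → ℤ)) j : ℂ)) ⬝ᵥ (WithLp.ofLp ((((((F) / (ν) * Real.sqrt 2 : ℝ) : ℂ) • (EuclideanSpace.complexify (EuclideanSpace.single (0 : Fin 3) (1 : ℝ)) : EuclideanSpace ℂ (Fin 3))))))) = 0 := dotc_e2_smul_zhat _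

/-- The one-mode sum of the shear state is the shear mode. -/
theorem modes_shear (zs : (EuclideanSpace ℂ (Fin 3))) : (∑ mm, Torus.realTrigPoly {![(![0, 1, 0] : Fin 3 → ℤ)] mm} (fun _ => ![zs] mm)) = (Torus.realTrigPoly {(![0, 1, 0] : Fin 3 → ℤ)} (fun _ => zs)) := by
  funext x
  rw [modes_apply]
  simp

/-- Energy of the shear state: `∫ ‖uₑ‖² = F²/ν²`. -/
theorem integral_norm_sq_modes_shear {F ν : ℝ} (hF : 0 ≤ F) (hν : 0 < ν) :
    ∫ x, ‖(∑ mm, Torus.realTrigPoly {![(![0, 1, 0] : Fin 3 → ℤ)] mm} (fun _ => ![((((F) / (ν) * Real.sqrt 2 : ℝ) : ℂ) • (EuclideanSpace.complexify (EuclideanSpace.single (0 : Fin 3) (1 : ℝ)) : EuclideanSpace ℂ (Fin 3)))] mm)) x‖ ^ 2 = F ^ 2 / ν ^ 2 := by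
  rw [modes_shear, integral_norm_sq_mode e2_ne_zero, norm_zsh hF hν, mul_pow,
    Real.sq_sqrt (by norm_num : (0:ℝ) ≤ 2)]
  ring

/-- One Laplacian term in Fourier variables, bounded by the truncated norm. -/
theorem laplacian_term_le {G : (UnitAddTorus (Fin 3)) → (EuclideanSpace ℝ (Fin 3))} {N : ℕ}
    (hband : ∀ κ, (N : ℝ) ^ 2 < Torus.freqNormSq κ → mFourierCoeff (EuclideanSpace.complexify ∘ G) κ = 0)
    (zs : (EuclideanSpace ℂ (Fin 3))) :
    |(⟪zs, -(((4 * Real.pi ^ 2 * Torus.freqNormSq (![0, 1, 0] : Fin 3 → ℤ) : ℝ) : ℂ) • (mFourierCoeff (EuclideanSpace.complexify ∘ G) (![0, 1, 0] : Fin 3 → ℤ)))⟫_ℂ).re| ≤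
      ‖zs‖ * (4 * Real.pi ^ 2) * (Real.sqrt (∑ κ' ∈ Torus.freqBall N, ‖mFourierCoeff (EuclideanSpace.complexify ∘ G) κ'‖ ^ 2)) := by
  rw [freqNormSq_e2, mul_one]
  refine (abs_re_inner_le_norm_mul _ _).trans ?_
  have h4 : (0 : ℝ) ≤ 4 * Real.pi ^ 2 := by positivity
  rw [norm_neg, norm_smul, Complex.norm_real, Real.norm_of_nonneg h4]
  have h := norm_fc_le_coeffNorm hband (![0, 1, 0] : Fin 3 → ℤ)
  have hz := norm_nonneg zs
  calc ‖zs‖ * (4 * Real.pi ^ 2 * ‖(mFourierCoeff (EuclideanSpace.complexify ∘ G) (![0, 1, 0] : Fin 3 → ℤ))‖) = (‖zs‖ * (4 * Real.pi ^ 2)) * ‖(mFourierCoeff (EuclideanSpace.complexify ∘ G) (![0, 1, 0] : Fin 3 → ℤ))‖ := by ring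
    _ ≤ (‖zs‖ * (4 * Real.pi ^ 2)) * (Real.sqrt (∑ κ' ∈ Torus.freqBall N, ‖mFourierCoeff (EuclideanSpace.complexify ∘ G) κ'‖ ^ 2)) := mul_le_mul_of_nonneg_left h (by positivity)

/-- The Laplacian pairing of the shear state. -/
theorem laplacian_term_shear {G : (UnitAddTorus (Fin 3)) → (EuclideanSpace ℝ (Fin 3))} (hG : Torus.IsSmooth G) {N : ℕ}
    (hband : ∀ κ, (N : ℝ) ^ 2 < Torus.freqNormSq κ → mFourierCoeff (EuclideanSpace.complexify ∘ G) κ = 0)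
    (zs : (EuclideanSpace ℂ (Fin 3))) :
    |∫ x, ⟪(∑ mm, Torus.realTrigPoly {![(![0, 1, 0] : Fin 3 → ℤ)] mm} (fun _ => ![zs] mm)) x, Torus.laplacian G x⟫_ℝ| ≤ ‖zs‖ * (4 * Real.pi ^ 2) * (Real.sqrt (∑ κ' ∈ Torus.freqBall N, ‖mFourierCoeff (EuclideanSpace.complexify ∘ G) κ'‖ ^ 2)) := by
  rw [integral_inner_modes_laplacian hG]
  simp only [Fin.sum_univ_one, Matrix.cons_val_zero, Fin.isValue]
  exact laplacian_term_le hband zs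

/-- The Laplacian pairing of the beat state: the two unresolved modes do not contribute. -/
theorem laplacian_term_three {G : (UnitAddTorus (Fin 3)) → (EuclideanSpace ℝ (Fin 3))} (hG : Torus.IsSmooth G) {N : ℕ}
    (hband : ∀ κ, (N : ℝ) ^ 2 < Torus.freqNormSq κ → mFourierCoeff (EuclideanSpace.complexify ∘ G) κ = 0)
    (zs zA zB : (EuclideanSpace ℂ (Fin 3))) {p q : Fin 3 → ℤ} (hp : (mFourierCoeff (EuclideanSpace.complexify ∘ G) p) = 0) (hpq : (mFourierCoeff (EuclideanSpace.complexify ∘ G) (p + q)) = 0) :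
    |∫ x, ⟪(∑ mm, Torus.realTrigPoly {![(![0, 1, 0] : Fin 3 → ℤ), p, p + q] mm} (fun _ => ![zs, zA, zB] mm)) x, Torus.laplacian G x⟫_ℝ| ≤
      ‖zs‖ * (4 * Real.pi ^ 2) * (Real.sqrt (∑ κ' ∈ Torus.freqBall N, ‖mFourierCoeff (EuclideanSpace.complexify ∘ G) κ'‖ ^ 2)) := by
  rw [integral_inner_modes_laplacian hG]
  simp only [Fin.sum_univ_three, Matrix.cons_val_zero, Matrix.cons_val_one, Matrix.cons_val_two,
    Matrix.head_cons, Matrix.tail_cons, hp, hpq, smul_zero, neg_zero, inner_zero_right,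
    Complex.zero_re, add_zero, Fin.isValue]
  exact laplacian_term_le hband zs

/-- Pairing of a mode sum with the force: `|(u, f)| ≤ (∑ ‖z_m‖) ‖f‖₂`. -/
theorem pairing_bound {n : ℕ} {k : Fin n → (Fin 3 → ℤ)} {z : Fin n → (EuclideanSpace ℂ (Fin 3))} {f : (UnitAddTorus (Fin 3)) → (EuclideanSpace ℝ (Fin 3))}
    (hf : Torus.IsSmooth f) :
    |∫ x, ⟪(∑ mm, Torus.realTrigPoly {k mm} (fun _ => z mm)) x, f x⟫_ℝ| ≤ (∑ m, ‖z m‖) * Real.sqrt (∫ x, ‖f x‖ ^ 2) := by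
  rw [integral_inner_modes_left hf.integrable, Finset.sum_mul]
  refine (Finset.abs_sum_le_sum_abs _ _).trans (Finset.sum_le_sum fun m _ => ?_)
  exact (abs_re_inner_le_norm_mul _ _).trans
    (mul_le_mul_of_nonneg_left (norm_fc_le_sqrt_integral (hf.memLp 2) _) (norm_nonneg _))

/-! ### Evaluation at rest (`u = 0`): the force cannot vanish -/

/-- The `L²` representative of `0 ∈ H` vanishes a.e. -/
theorem coe_zero_ae : (((0 : (Torus.energySpace (Fin 3))) : (Lp (EuclideanSpace ℝ (Fin 3)) 2 (volume : Measure (UnitAddTorus (Fin 3))))) : (UnitAddTorus (Fin 3)) → (EuclideanSpace ℝ (Fin 3))) =ᵐ[volume] (0 : (UnitAddTorus (Fin 3)) → (EuclideanSpace ℝ (Fin 3))) :=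
  Lp.coeFn_zero _ _ _

/-- The spectral gradient norm of the zero field vanishes. -/
theorem eGradNormSq_zero_field : Torus.eGradNormSq (0 : (UnitAddTorus (Fin 3)) → (EuclideanSpace ℝ (Fin 3))) = 0 := by
  have h := Torus.eGradNormSq_realTrigPoly (d := Fin 3) (S := ∅) (fun k hk => by simp at hk)
    Torus.isConjSymm_zero
  rw [Torus.realTrigPoly_zero] at h
  rw [h]
  simp

/-- The spectral gradient norm of the representative of `0 ∈ H` vanishes. -/
theorem eGradNormSq_coe_zero : Torus.eGradNormSq (((0 : (Torus.energySpace (Fin 3))) : (Lp (EuclideanSpace ℝ (Fin 3)) 2 (volume : Measure (UnitAddTorus (Fin 3))))) : (UnitAddTorus (Fin 3)) → (EuclideanSpace ℝ (Fin 3))) = 0 := by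
  rw [eGradNormSq_congr_ae' coe_zero_ae, eGradNormSq_zero_field]

/-- At rest and for an a.e.-vanishing force every term of the certificate vanishes. -/
theorem certificate_terms_at_zero {f : (UnitAddTorus (Fin 3)) → (EuclideanSpace ℝ (Fin 3))} (hf : f =ᵐ[volume] 0) (ν θ : ℝ) (W : (UnitAddTorus (Fin 3)) → (EuclideanSpace ℝ (Fin 3))) :
    ν * (Torus.eGradNormSq (((0 : (Torus.energySpace (Fin 3))) : (Lp (EuclideanSpace ℝ (Fin 3)) 2 (volume : Measure (UnitAddTorus (Fin 3))))) : (UnitAddTorus (Fin 3)) → (EuclideanSpace ℝ (Fin 3)))).toReal +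
        Torus.nsGeneratorPairing ν f (0 : (Torus.energySpace (Fin 3))) W +
      2 * θ * (Torus.pairing ((0 : (Torus.energySpace (Fin 3))) : (Lp (EuclideanSpace ℝ (Fin 3)) 2 (volume : Measure (UnitAddTorus (Fin 3))))) f - ν * (Torus.eGradNormSq (((0 : (Torus.energySpace (Fin 3))) : (Lp (EuclideanSpace ℝ (Fin 3)) 2 (volume : Measure (UnitAddTorus (Fin 3))))) : (UnitAddTorus (Fin 3)) → (EuclideanSpace ℝ (Fin 3)))).toReal) = 0 := by
  have h1 : (∫ x, ⟪f x, W x⟫_ℝ) = 0 := by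
    rw [← integral_zero (α := (UnitAddTorus (Fin 3))) (G := ℝ)]
    refine integral_congr_ae ?_
    filter_upwards [hf] with x hx
    simp [hx]
  have h2 : (∫ x, ⟪(((0 : (Torus.energySpace (Fin 3))) : (Lp (EuclideanSpace ℝ (Fin 3)) 2 (volume : Measure (UnitAddTorus (Fin 3))))) : (UnitAddTorus (Fin 3)) → (EuclideanSpace ℝ (Fin 3))) x, Torus.laplacian W x⟫_ℝ) = 0 := by
    rw [← integral_zero (α := (UnitAddTorus (Fin 3))) (G := ℝ)]
    refine integral_congr_ae ?_
    filter_upwards [coe_zero_ae] with x hx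
    rw [hx]
    simp
  have h3 : (∫ x, ⟪Torus.fderiv W x ((((0 : (Torus.energySpace (Fin 3))) : (Lp (EuclideanSpace ℝ (Fin 3)) 2 (volume : Measure (UnitAddTorus (Fin 3))))) : (UnitAddTorus (Fin 3)) → (EuclideanSpace ℝ (Fin 3))) x), (((0 : (Torus.energySpace (Fin 3))) : (Lp (EuclideanSpace ℝ (Fin 3)) 2 (volume : Measure (UnitAddTorus (Fin 3))))) : (UnitAddTorus (Fin 3)) → (EuclideanSpace ℝ (Fin 3))) x⟫_ℝ) = 0 := by
    rw [← integral_zero (α := (UnitAddTorus (Fin 3))) (G := ℝ)]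
    refine integral_congr_ae ?_
    filter_upwards [coe_zero_ae] with x hx
    rw [hx]
    simp
  have h4 : Torus.pairing ((0 : (Torus.energySpace (Fin 3))) : (Lp (EuclideanSpace ℝ (Fin 3)) 2 (volume : Measure (UnitAddTorus (Fin 3))))) f = 0 := by
    unfold Torus.pairing
    rw [← integral_zero (α := (UnitAddTorus (Fin 3))) (G := ℝ)]
    refine integral_congr_ae ?_
    filter_upwards [coe_zero_ae] with x hx
    rw [hx]
    simp
  unfold Torus.nsGeneratorPairing Torus.inertialPairing
  rw [h1, h2, h3, h4, eGradNormSq_coe_zero]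
  simp

/-- A smooth force with `∫ ‖f‖² = 0` vanishes a.e. -/
theorem ae_zero_of_integral_sq_zero {f : (UnitAddTorus (Fin 3)) → (EuclideanSpace ℝ (Fin 3))} (hf : Torus.IsSmooth f) (h0 : ∫ x, ‖f x‖ ^ 2 = 0) :
    f =ᵐ[volume] 0 := by
  have hint : Integrable (fun x => ‖f x‖ ^ 2) volume := (hf.memLp 2).integrable_norm_pow two_ne_zero
  have h := (integral_eq_zero_iff_of_nonneg (fun x => by positivity) hint).1 h0
  filter_upwards [h] with x hx
  simpa using hx

end Summit.AnomalousDissipation.AnomalousDissipation.Theorems.TaylorCertificatePair.Negative
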